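import Summits.Ventures.LatticeQCDFlow.Scaling.ClockConditionedMixingTime

/-!
HONEST FRAMING: exact (Metropolis-corrected) sampling algorithms for lattice gauge theory; figures
of merit are autocorrelation/cost numbers at stated couplings and volumes; no continuum-physics
claim.

# ClockConditionedPairRates — THE CLOCK-CONDITIONED STEP LAW WITH PAIR-DEPENDENT SIGNED PER-ATTEMPT-COUNT RATES: `‖Sⁿ(x,·) − Sⁿ(y,·)‖_TV ≤ (γⁿ/δ)·ρ(x,y)` FROM A
# PER-PAIR CHARACTERISTIC INEQUALITY, HENCE `d_S(n) ≤ (2D/r̃)(1+ε)⁻ⁿ` AND `t_mix^S(ε₀) ≤ ⌈(log(2D/r̃) − log ε₀)/log(1+ε)⌉`, `ε = (1−σ)r̃/(8(1+q))`, FROM THE PER-PAIR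
# MEAN-RATE CONDITION `Σ_{j<n}σʲ(1−σ)(1 − r_j(x,y)) ≤ 1 − r̃` (lean-2 GEN-43, ours)

Venture-side (OURS).  Cell `lqcd-flow` (pub-lqcd), unit `pub-lqcd-lean-2-g43`, 2026-08-31.  Chapter AC, file 4 — the first piece of the C2 ∕ C4 assembly for the lumped star.
Chapter Y files C1–C4 (`ClockConditionedContraction`, `…Renewal`, `…MixingTime`, `…SelfContained`) take ONE rate sequence `r_j` valid for every pair: `ρ_K(C_j(x,·),C_j(y,·)) ≤
(1−r_j)ρ(x,y)`.  What the per-edge certificates of chapters Z–AC deliver is PAIR-DEPENDENT: on an adjacent edge `(x,y)` the `j`-attempt cycle kernel `C_j = AʲB` contracts the potential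
by a signed amount `Q_j(x,y)` whose σ-DISCOUNTED SUM is non-negative (Conjecture W′, `TaggedPerAttemptCertificateEveryEdgeAll`), and the infimum over pairs of `Q_j(x,y)/ρ(x,y)` at fixed
`j` may be very negative at some pair for every `j`.  The supersolution argument of C2 (`renewal_le_geometric`) does not need uniformity: with `r_j(x,y) ≤ 1` and the characteristic
inequality `Σ_{j<n}σʲ(1−σ)(1−r_j(x,y))(γ⁻¹)ʲ⁺¹ ≤ 1 − δ` at EVERY pair, the bound `‖Sⁿ(x,·) − Sⁿ(y,·)‖_TV ≤ (γⁿ/δ)ρ(x,y)` propagates through C1's first-`B` decomposition pair by pair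
(the no-`B` branch needs only `σ ≤ γ`).  C2's `renewal_characteristic` (a statement about one real sequence) then supplies `γ⁻¹ = 1+ε`, `δ = r̃/2` at each pair from the per-pair mean
condition with `−q ≤ r_j(x,y) ≤ 1`.

* §1 **`clock_pair_tvDist_le_pairRates`**: `‖Sⁿ(x,·) − Sⁿ(y,·)‖_TV ≤ (γⁿ/δ)·ρ(x,y)` for all `n, x, y` (pair-dependent rates, geometric supersolution).
* §2 `clock_pairRates_characteristic` (the per-pair characteristic inequality from the per-pair mean condition), **`clock_worstTvDist_le_pairRates`**:
  `d_S(n) ≤ (2D/r̃)·((1+ε)⁻¹)ⁿ`, **`clock_mixingTime_le_pairRates`**: `t_mix^S(ε₀) ≤ ⌈(−log ε₀ + log(2D/r̃))/log(1+ε)⌉₊`, `ε = (1−σ)r̃/(8(1+q))`.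

Hypotheses left to the user (as C4): `A, B ≥ 0` with unit row sums, `0 ≤ σ < 1`, `S = σA + (1−σ)B`, the powers `Sⁿ, Aⁿ` and cycle kernels `C_j` by their recursions, a cost `ρ` with
`ρ(x,x) = 0`, `1 ≤ ρ(x,y) ≤ D` off the diagonal, PAIR-DEPENDENT rates `−q ≤ r_j(x,y) ≤ 1` with `Σ_{j<n}σʲ(1−σ)(1−r_j(x,y)) ≤ 1 − r̃` for every `n` and every pair, the contraction
`ρ_K(C_j(x,·),C_j(y,·)) ≤ (1−r_j(x,y))ρ(x,y)`, a stationary probability vector `π`.  Since every term `1 − r_j(x,y)` is non-negative, the mean condition for every `n` follows from any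
bound on the full discounted sum — which for the lumped star is the CYCLE-level contraction of chapter W evaluated on the σ-mixture of the per-`j` couplings (memo MEMO-gen43 §3: the
remaining steps of the assembly and the one new term, the penalty pairs of the per-`j` optimal coupling at the start content).  Literature grade (cell rule): OWN, elementary; nothing
cited; no new bib keys.
-/

open Finset
open Literature.Probability.MarkovChains

namespace Summit.Ventures.LatticeQCDFlow.Scaling

section PairRates
variable {X : Type*} [Fintype X] [DecidableEq X]
variable {A B S : X → X → ℝ} {σ : ℝ} {Sn An C : ℕ → X → X → ℝ} {ρ : X → X → ℝ} {r : ℕ → X → X → ℝ} {D rt : ℝ}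

/-! ### §1 Pair-dependent rates, geometric supersolution -/

/-- **CLOCK-CONDITIONED CONTRACTION OF PAIRS WITH PAIR-DEPENDENT RATES.**  `A, B ≥ 0` with unit row sums, `0 ≤ σ < 1`, `S = σA + (1−σ)B`; a cost `ρ` with `ρ(x,x) = 0` and
`ρ(x,y) ≥ 1` for `x ≠ y`; for every attempt count `j` and every pair, `ρ_K(C_j(x,·),C_j(y,·)) ≤ (1−r_j(x,y))ρ(x,y)` (any real `r_j(x,y)`); constants `0 < γ`, `σ ≤ γ`, `0 < δ` with the
characteristic inequality `Σ_{j<n}σʲ(1−σ)(1−r_j(x,y))(γ⁻¹)ʲ⁺¹ ≤ 1 − δ` at every pair for every `n`.  Then **`‖Sⁿ(x,·) − Sⁿ(y,·)‖_TV ≤ (γⁿ/δ)·ρ(x,y)`** for all `n, x, y`. [ours] -/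
theorem clock_pair_tvDist_le_pairRates (hA0 : ∀ x y, 0 ≤ A x y) (hA1 : ∀ x, ∑ y, A x y = 1) (hB0 : ∀ x y, 0 ≤ B x y) (hB1 : ∀ x, ∑ y, B x y = 1)
    (hσ0 : 0 ≤ σ) (hσ1 : σ < 1) (hS : ∀ x y, S x y = σ * A x y + (1 - σ) * B x y)
    (hSn0 : ∀ x y, Sn 0 x y = if x = y then 1 else 0) (hSns : ∀ n x y, Sn (n + 1) x y = ∑ z, S x z * Sn n z y)
    (hAn0 : ∀ x y, An 0 x y = if x = y then 1 else 0) (hAns : ∀ n x y, An (n + 1) x y = ∑ z, A x z * An n z y)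
    (hC0 : ∀ x y, C 0 x y = B x y) (hCs : ∀ j x y, C (j + 1) x y = ∑ z, A x z * C j z y)
    (hρd : ∀ x, ρ x x = 0) (hρ1 : ∀ x y, x ≠ y → 1 ≤ ρ x y)
    (hcontr : ∀ j x y, transportDist ρ (C j x) (C j y) ≤ (1 - r j x y) * ρ x y)
    {γ δ : ℝ} (hγ0 : 0 < γ) (hσγ : σ ≤ γ) (hδ : 0 < δ)
    (hchar : ∀ n x y, ∑ j ∈ range n, σ ^ j * (1 - σ) * (1 - r j x y) * (γ⁻¹) ^ (j + 1) ≤ 1 - δ) :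
    ∀ n x y, tvDist (Sn n x) (Sn n y) ≤ γ ^ n / δ * ρ x y := by
  classical
  have hSrs : (∀ x y, 0 ≤ S x y) ∧ ∀ x, ∑ y, S x y = 1 := by
    refine ⟨fun x y => by rw [hS]; exact add_nonneg (mul_nonneg hσ0 (hA0 x y)) (mul_nonneg (by linarith) (hB0 x y)), fun x => ?_⟩
    simp_rw [hS]; rw [sum_add_distrib, ← mul_sum, ← mul_sum, hA1, hB1]; ring
  intro n
  induction n using Nat.strong_induction_on with
  | _ n ih =>
      intro x y
      have hρ0 : 0 ≤ ρ x y := by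
        by_cases hxy : x = y
        · subst hxy; rw [hρd]
        · exact zero_le_one.trans (hρ1 x y hxy)
      have hAn := clock_pow_rowStochastic hA0 hA1 hAn0 hAns n
      have hC := clock_cycle_rowStochastic hA0 hA1 hB0 hB1 hC0 hCs
      have hgn : 0 ≤ γ ^ n / δ := div_nonneg (pow_nonneg hγ0.le n) hδ.le
      -- both laws as the same mixture over the first-`B` time, plus the no-`B` branch
      have ex : Sn n x = fun w => (∑ j ∈ range n, (σ ^ j * (1 - σ)) * stepLaw (Sn (n - 1 - j)) (C j x) w) + σ ^ n * An n x w := by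
        funext w; rw [clock_firstB hS hSn0 hSns hAn0 hAns hC0 hCs n x w]; rfl
      have ey : Sn n y = fun w => (∑ j ∈ range n, (σ ^ j * (1 - σ)) * stepLaw (Sn (n - 1 - j)) (C j y) w) + σ ^ n * An n y w := by
        funext w; rw [clock_firstB hS hSn0 hSns hAn0 hAns hC0 hCs n y w]; rfl
      rw [ex, ey]
      refine (clock_tvDist_add_le _ _ _ _).trans ?_
      -- `γ^{n−1−j}/δ = (γⁿ/δ)·(γ⁻¹)^{j+1}` for `j < n`
      have e : ∀ j ∈ range n, σ ^ j * (1 - σ) * (1 - r j x y) * (γ ^ (n - 1 - j) / δ) * ρ x y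
          = (γ ^ n / δ * ρ x y) * (σ ^ j * (1 - σ) * (1 - r j x y) * (γ⁻¹) ^ (j + 1)) := by
        intro j hj
        have hjn := mem_range.mp hj
        have hγn : γ ^ n = γ ^ (n - 1 - j) * γ ^ (j + 1) := by rw [← pow_add]; congr 1; omega
        rw [hγn, inv_pow]
        field_simp
      have hsum : tvDist (fun w => ∑ j ∈ range n, (σ ^ j * (1 - σ)) * stepLaw (Sn (n - 1 - j)) (C j x) w)
          (fun w => ∑ j ∈ range n, (σ ^ j * (1 - σ)) * stepLaw (Sn (n - 1 - j)) (C j y) w) ≤ (γ ^ n / δ * ρ x y) * (1 - δ) := by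
        refine (clock_tvDist_sum_le (range n) (fun j _ => mul_nonneg (pow_nonneg hσ0 j) (by linarith)) _ _).trans ?_
        calc ∑ j ∈ range n, σ ^ j * (1 - σ) * tvDist (stepLaw (Sn (n - 1 - j)) (C j x)) (stepLaw (Sn (n - 1 - j)) (C j y))
            ≤ ∑ j ∈ range n, σ ^ j * (1 - σ) * (1 - r j x y) * (γ ^ (n - 1 - j) / δ) * ρ x y := by
              refine sum_le_sum fun j hj => ?_
              have hjn : n - 1 - j < n := by have := mem_range.mp hj; omega
              have hne : (couplings (C j x) (C j y)).Nonempty :=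
                couplings_nonempty (fun a => (hC j).1 x a) (fun b => (hC j).1 y b) ((hC j).2 x) ((hC j).2 y)
              obtain ⟨q, hq, hqopt, -⟩ := LevinPeres2017_rem_14_2 ρ hne
              have hum : 0 ≤ γ ^ (n - 1 - j) / δ := div_nonneg (pow_nonneg hγ0.le _) hδ.le
              have hw : 0 ≤ σ ^ j * (1 - σ) := mul_nonneg (pow_nonneg hσ0 j) (by linarith)
              calc σ ^ j * (1 - σ) * tvDist (stepLaw (Sn (n - 1 - j)) (C j x)) (stepLaw (Sn (n - 1 - j)) (C j y))
                  ≤ σ ^ j * (1 - σ) * ∑ a, ∑ b, q a b * tvDist (Sn (n - 1 - j) a) (Sn (n - 1 - j) b) :=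
                    mul_le_mul_of_nonneg_left (clock_tvDist_coupling_le _ hq) hw
                _ ≤ σ ^ j * (1 - σ) * ∑ a, ∑ b, q a b * (γ ^ (n - 1 - j) / δ * ρ a b) :=
                    mul_le_mul_of_nonneg_left (sum_le_sum fun a _ => sum_le_sum fun b _ => mul_le_mul_of_nonneg_left (ih _ hjn a b) (hq.1 a b)) hw
                _ = σ ^ j * (1 - σ) * (γ ^ (n - 1 - j) / δ * transportCost ρ q) := by
                    congr 1; unfold transportCost; rw [mul_sum]; exact sum_congr rfl fun a _ => by rw [mul_sum]; exact sum_congr rfl fun b _ => by ring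
                _ ≤ σ ^ j * (1 - σ) * (γ ^ (n - 1 - j) / δ * ((1 - r j x y) * ρ x y)) := by
                    refine mul_le_mul_of_nonneg_left (mul_le_mul_of_nonneg_left ?_ hum) hw
                    rw [hqopt]; exact hcontr j x y
                _ = σ ^ j * (1 - σ) * (1 - r j x y) * (γ ^ (n - 1 - j) / δ) * ρ x y := by ring
          _ = (γ ^ n / δ * ρ x y) * ∑ j ∈ range n, σ ^ j * (1 - σ) * (1 - r j x y) * (γ⁻¹) ^ (j + 1) := by rw [sum_congr rfl e, mul_sum]
          _ ≤ (γ ^ n / δ * ρ x y) * (1 - δ) := mul_le_mul_of_nonneg_left (hchar n x y) (mul_nonneg hgn hρ0)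
      have hnoB : tvDist (fun w => σ ^ n * An n x w) (fun w => σ ^ n * An n y w) ≤ γ ^ n * ρ x y := by
        rw [clock_tvDist_smul (pow_nonneg hσ0 n)]
        have h1 : tvDist (An n x) (An n y) ≤ ρ x y := by
          by_cases hxy : x = y
          · subst hxy; rw [tvDist_self, hρd]
          · exact (tvDist_le_one (hAn.1 x) (hAn.1 y) (hAn.2 x) (hAn.2 y)).trans (hρ1 x y hxy)
        have h2 : σ ^ n ≤ γ ^ n := pow_le_pow_left₀ hσ0 hσγ n
        calc σ ^ n * tvDist (An n x) (An n y) ≤ γ ^ n * tvDist (An n x) (An n y) := mul_le_mul_of_nonneg_right h2 (tvDist_nonneg _ _)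
          _ ≤ γ ^ n * ρ x y := mul_le_mul_of_nonneg_left h1 (pow_nonneg hγ0.le n)
      calc tvDist (fun w => ∑ j ∈ range n, (σ ^ j * (1 - σ)) * stepLaw (Sn (n - 1 - j)) (C j x) w)
              (fun w => ∑ j ∈ range n, (σ ^ j * (1 - σ)) * stepLaw (Sn (n - 1 - j)) (C j y) w)
            + tvDist (fun w => σ ^ n * An n x w) (fun w => σ ^ n * An n y w)
          ≤ (γ ^ n / δ * ρ x y) * (1 - δ) + γ ^ n * ρ x y := add_le_add hsum hnoB
        _ = γ ^ n / δ * ρ x y := by field_simp; ring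

/-! ### §2 The per-pair mean condition: worst-case law and mixing time -/

omit [Fintype X] [DecidableEq X] in
/-- **The per-pair characteristic inequality from the per-pair mean rate** (C2 `renewal_characteristic` at every pair): with `0 ≤ σ < 1`, `0 < r̃ ≤ 1`, `0 ≤ q`,
`−q ≤ r_j(x,y) ≤ 1`, `Σ_{j<n}σʲ(1−σ)(1−r_j(x,y)) ≤ 1 − r̃` (all `n`, all pairs), `ε = (1−σ)r̃/(8(1+q))`:
`Σ_{j<n}σʲ(1−σ)(1−r_j(x,y))(1+ε)ʲ⁺¹ ≤ 1 − r̃/2` for every `n` and every pair, and `σ(1+ε) ≤ 1`. [ours] -/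
theorem clock_pairRates_characteristic (hσ0 : 0 ≤ σ) (hσ1 : σ < 1) (hrt0 : 0 < rt) (hrt1 : rt ≤ 1) {q : ℝ} (hq : 0 ≤ q)
    (hrq : ∀ j x y, -q ≤ r j x y) (hr1 : ∀ j x y, r j x y ≤ 1) (hmean : ∀ n x y, ∑ j ∈ range n, σ ^ j * (1 - σ) * (1 - r j x y) ≤ 1 - rt)
    {ε : ℝ} (hε : ε = (1 - σ) * rt / (8 * (1 + q))) :
    (∀ n x y, ∑ j ∈ range n, σ ^ j * (1 - σ) * (1 - r j x y) * (1 + ε) ^ (j + 1) ≤ 1 - rt / 2) ∧ σ * (1 + ε) ≤ 1 := by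
  classical
  refine ⟨fun n x y => (renewal_characteristic hσ0 hσ1 hrt0 hrt1 hq (fun j => hrq j x y) (fun j => hr1 j x y) (fun m => hmean m x y) hε n).1, ?_⟩
  -- the second conjunct does not depend on the pair; any pair (or none) will do
  have h8 : 0 < 8 * (1 + q) := by linarith
  have hεle : ε ≤ (1 - σ) / 8 := by
    rw [hε, div_le_div_iff₀ h8 (by norm_num : (0:ℝ) < 8)]
    nlinarith [mul_nonneg (by linarith : (0:ℝ) ≤ 1 - σ) hq, mul_nonneg (by linarith : (0:ℝ) ≤ 1 - σ) hrt0.le]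
  have hε0 : 0 ≤ ε := by rw [hε]; exact div_nonneg (mul_nonneg (by linarith) hrt0.le) h8.le
  nlinarith [mul_nonneg hσ0 hε0]

/-- **`d_S(n) ≤ (2D/r̃)·((1+ε)⁻¹)ⁿ` with pair-dependent signed rates** (see the module docstring). [ours] -/
theorem clock_worstTvDist_le_pairRates (hA0 : ∀ x y, 0 ≤ A x y) (hA1 : ∀ x, ∑ y, A x y = 1) (hB0 : ∀ x y, 0 ≤ B x y) (hB1 : ∀ x, ∑ y, B x y = 1)
    (hσ0 : 0 ≤ σ) (hσ1 : σ < 1) (hS : ∀ x y, S x y = σ * A x y + (1 - σ) * B x y)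
    (hSn0 : ∀ x y, Sn 0 x y = if x = y then 1 else 0) (hSns : ∀ n x y, Sn (n + 1) x y = ∑ z, S x z * Sn n z y)
    (hAn0 : ∀ x y, An 0 x y = if x = y then 1 else 0) (hAns : ∀ n x y, An (n + 1) x y = ∑ z, A x z * An n z y)
    (hC0 : ∀ x y, C 0 x y = B x y) (hCs : ∀ j x y, C (j + 1) x y = ∑ z, A x z * C j z y)
    (hρd : ∀ x, ρ x x = 0) (hρ1 : ∀ x y, x ≠ y → 1 ≤ ρ x y) (hρD : ∀ x y, ρ x y ≤ D)
    {q : ℝ} (hq : 0 ≤ q) (hrq : ∀ j x y, -q ≤ r j x y) (hr1 : ∀ j x y, r j x y ≤ 1) (hrt0 : 0 < rt) (hrt1 : rt ≤ 1)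
    (hmean : ∀ n x y, ∑ j ∈ range n, σ ^ j * (1 - σ) * (1 - r j x y) ≤ 1 - rt)
    (hcontr : ∀ j x y, transportDist ρ (C j x) (C j y) ≤ (1 - r j x y) * ρ x y)
    {π : X → ℝ} (hπ0 : ∀ x, 0 ≤ π x) (hπ1 : ∑ x, π x = 1) (hπS : IsStationary π S)
    {ε : ℝ} (hε : ε = (1 - σ) * rt / (8 * (1 + q))) (n : ℕ) :
    worstTvDist S π n ≤ 2 * D / rt * ((1 + ε)⁻¹) ^ n := by
  classical
  have hε0 : 0 ≤ ε := by rw [hε]; exact div_nonneg (mul_nonneg (by linarith) hrt0.le) (by linarith)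
  have hγ0 : 0 < (1 + ε)⁻¹ := inv_pos.mpr (by linarith)
  have hch := clock_pairRates_characteristic hσ0 hσ1 hrt0 hrt1 hq hrq hr1 hmean hε
  have hσγ : σ ≤ (1 + ε)⁻¹ := by rw [inv_eq_one_div, le_div_iff₀ (by linarith)]; exact hch.2
  have hchar : ∀ m x y, ∑ j ∈ range m, σ ^ j * (1 - σ) * (1 - r j x y) * (((1 + ε)⁻¹)⁻¹) ^ (j + 1) ≤ 1 - rt / 2 := by
    intro m x y; rw [inv_inv]; exact hch.1 m x y
  have hpair := clock_pair_tvDist_le_pairRates hA0 hA1 hB0 hB1 hσ0 hσ1 hS hSn0 hSns hAn0 hAns hC0 hCs hρd hρ1 hcontr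
    hγ0 hσγ (by linarith : 0 < rt / 2) hchar n
  have hgn : 0 ≤ (1 + ε)⁻¹ ^ n / (rt / 2) := div_nonneg (pow_nonneg hγ0.le n) (by linarith)
  cases isEmpty_or_nonempty X with
  | inl h =>
      have : (∑ x, π x) = 0 := Finset.sum_eq_zero fun x _ => (IsEmpty.false x).elim
      rw [hπ1] at this; exact absurd this one_ne_zero
  | inr h =>
      refine ciSup_le fun x => ?_
      -- `π = πSⁿ` is the `π`-mixture of the rows of `Sⁿ`, and `Sⁿ(x,·)` is the same mixture of the constant family
      rw [clock_lawAt_single hSn0 hSns x n, ← lawAt_eq_self_of_isStationary hπS n, clock_lawAt_eq hSn0 hSns π n]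
      have ex : Sn n x = fun w => ∑ a, π a * Sn n x w := by funext w; rw [← sum_mul, hπ1, one_mul]
      have eπ : stepLaw (Sn n) π = fun w => ∑ a, π a * Sn n a w := rfl
      rw [ex, eπ]
      calc tvDist (fun w => ∑ a, π a * Sn n x w) (fun w => ∑ a, π a * Sn n a w)
          ≤ ∑ a, π a * tvDist (Sn n x) (Sn n a) := clock_tvDist_sum_le univ (fun a _ => hπ0 a) (fun _ => Sn n x) (fun a => Sn n a)
        _ ≤ ∑ a, π a * ((1 + ε)⁻¹ ^ n / (rt / 2) * D) :=
            sum_le_sum fun a _ => mul_le_mul_of_nonneg_left ((hpair x a).trans (mul_le_mul_of_nonneg_left (hρD x a) hgn)) (hπ0 a)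
        _ = 2 * D / rt * ((1 + ε)⁻¹) ^ n := by rw [← sum_mul, hπ1]; field_simp

/-- **THE STEP-COUNT MIXING TIME WITH PAIR-DEPENDENT SIGNED RATES:** under the hypotheses of `clock_worstTvDist_le_pairRates` with `0 < ε₀`,
`t_mix^S(ε₀) ≤ ⌈(−log ε₀ + log(2D/r̃))/log(1+ε)⌉₊`, `ε = (1−σ)r̃/(8(1+q))` (order `((1+q)/((1−σ)r̃))·log(D/(r̃ε₀))`). [ours] -/
theorem clock_mixingTime_le_pairRates (hA0 : ∀ x y, 0 ≤ A x y) (hA1 : ∀ x, ∑ y, A x y = 1) (hB0 : ∀ x y, 0 ≤ B x y) (hB1 : ∀ x, ∑ y, B x y = 1)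
    (hσ0 : 0 ≤ σ) (hσ1 : σ < 1) (hS : ∀ x y, S x y = σ * A x y + (1 - σ) * B x y)
    (hSn0 : ∀ x y, Sn 0 x y = if x = y then 1 else 0) (hSns : ∀ n x y, Sn (n + 1) x y = ∑ z, S x z * Sn n z y)
    (hAn0 : ∀ x y, An 0 x y = if x = y then 1 else 0) (hAns : ∀ n x y, An (n + 1) x y = ∑ z, A x z * An n z y)
    (hC0 : ∀ x y, C 0 x y = B x y) (hCs : ∀ j x y, C (j + 1) x y = ∑ z, A x z * C j z y)
    (hρd : ∀ x, ρ x x = 0) (hρ1 : ∀ x y, x ≠ y → 1 ≤ ρ x y) (hρD : ∀ x y, ρ x y ≤ D)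
    {q : ℝ} (hq : 0 ≤ q) (hrq : ∀ j x y, -q ≤ r j x y) (hr1 : ∀ j x y, r j x y ≤ 1) (hrt0 : 0 < rt) (hrt1 : rt ≤ 1)
    (hmean : ∀ n x y, ∑ j ∈ range n, σ ^ j * (1 - σ) * (1 - r j x y) ≤ 1 - rt)
    (hcontr : ∀ j x y, transportDist ρ (C j x) (C j y) ≤ (1 - r j x y) * ρ x y)
    {π : X → ℝ} (hπ0 : ∀ x, 0 ≤ π x) (hπ1 : ∑ x, π x = 1) (hπS : IsStationary π S)
    {ε : ℝ} (hε : ε = (1 - σ) * rt / (8 * (1 + q))) {ε₀ : ℝ} (hε₀ : 0 < ε₀) {N : ℕ}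
    (hN : (-Real.log ε₀ + Real.log (2 * D / rt)) / Real.log (1 + ε) ≤ N) :
    mixingTime S π ε₀ ≤ N := by
  have hεpos : 0 < ε := by rw [hε]; exact div_pos (mul_pos (by linarith) hrt0) (by linarith)
  have hα : 0 < Real.log (1 + ε) := Real.log_pos (by linarith)
  refine mixingTime_le S π ?_
  have hd := clock_worstTvDist_le_pairRates hA0 hA1 hB0 hB1 hσ0 hσ1 hS hSn0 hSns hAn0 hAns hC0 hCs hρd hρ1 hρD hq hrq hr1 hrt0 hrt1 hmean hcontr
    hπ0 hπ1 hπS hε N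
  -- `(1+ε)⁻¹ = e^{−log(1+ε)}`
  have hexp : (1 + ε)⁻¹ = Real.exp (-Real.log (1 + ε)) := by
    rw [Real.exp_neg, Real.exp_log (by linarith)]
  rw [hexp] at hd
  calc worstTvDist S π N ≤ 2 * D / rt * Real.exp (-Real.log (1 + ε)) ^ N := hd
    _ = Real.exp (-Real.log (1 + ε)) ^ N * (2 * D / rt) := by ring
    _ ≤ ε₀ := exp_neg_pow_mul_le hα hε₀ hN

end PairRates

end Summit.Ventures.LatticeQCDFlow.Scaling
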